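import Summits.ValiantsHypothesis.ValiantsHypothesis.Theorems.KPlusLogSqLawOctaveWitness

/-!
# Route «KPlusLogSqLaw», octave line — file 3/7: scales × clusters (`B ↔ Ω-B ∧ PO-B`) and the dilation correction `B ↔ PO-B`

HONEST FRAMING.  Octave line of ideator seat val-idea-6 (crux-idea `octave-lifting` on stmt-ValiantsHypothesis-19561, critic-1 PASS 2026-08-27), published as `Cruxes/WeakLifting/Lines/octave.lean`; landed in Theorems shape by prover seat val-width-19561-oc1 (`--supports stmt-ValiantsHypothesis-19561`).  Conjecture B (`KPlusLogSqLaw`), `TropicalB` (stmt-19771), `WeakLifting` (stmt-19561), `MatrixDescartes` (stmt-18050) and the octave statements `OctaveWeakLifting` / `OctaveKLaw` / `OctaveMatrixDescartes` are OPEN and DEFINED, never asserted; nothing in this file proves any of them, and VP ≠ VNP is not moved.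

This file: `scalePencil`, `PerOctaveRootLawAt`, `card_roots_le_one_add_octave_mul`, `kPlusLogSqLaw_iff_octave_and_perOctave`, `dilate`, `kPlusLogSqLaw_iff_perOctaveKLaw` (Conjecture B localises to ONE octave by odd degree dilation), `notB_trichotomy`.
-/

set_option linter.dupNamespace false
set_option autoImplicit false

namespace Summit.ValiantsHypothesis.ValiantsHypothesis.Theorems.KPlusLogSqLaw.Octave

open Polynomial Finset
open scoped BigOperators
open Summit.ValiantsHypothesis.ValiantsHypothesis.Theorems.LacunarySymmetroidMatrixDescartes (RealRootLawAt KPlusLogSqLaw)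
open Summit.ValiantsHypothesis.ValiantsHypothesis.Theses.LacunarySymmetroid (MatrixDescartes PencilTransfer ThetaWitness)
open Summit.ValiantsHypothesis.ValiantsHypothesis.Theses.KPlusLogSqLaw (TropicalB WeakLifting)

/-! ## Scales × clusters: `B ↔ Ω-B ∧ PO-B`, and the correction `B ↔ PO-B` (odd degree dilation) — the octave half is the weaker door -/

section ScalesClusters

open Polynomial Finset
open Summit.ValiantsHypothesis.ValiantsHypothesis.Theorems.LacunarySymmetroidMatrixDescartes (RealRootLawAt KPlusLogSqLaw)

/-- evaluation of the pencil determinant at a real point is the determinant of the evaluated pencil. [folklore] -/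
theorem eval_pencilDet {m K : ℕ} (d : Fin K → ℕ) (S : Fin K → Matrix (Fin m) (Fin m) ℝ) (u : ℝ) :
    (pencilDet d S).eval u = Matrix.det (∑ l, u ^ d l • S l) := by
  unfold pencilDet
  rw [← Polynomial.coe_evalRingHom, RingHom.map_det]
  congr 1
  ext i j
  simp [Matrix.sum_apply, Matrix.smul_apply, Matrix.map_apply]
  exact Finset.sum_congr rfl fun l _ => mul_comm _ _

/-- rescaled pencil: `S_l ↦ a^{d_l} S_l`. -/
noncomputable def scalePencil {m K : ℕ} (a : ℝ) (d : Fin K → ℕ) (S : Fin K → Matrix (Fin m) (Fin m) ℝ) :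
    Fin K → Matrix (Fin m) (Fin m) ℝ := fun l => a ^ d l • S l

/-- Dyadic rescaling of the letters preserves symmetry. [folklore] -/
theorem scalePencil_isSymm {m K : ℕ} (a : ℝ) (d : Fin K → ℕ) (S : Fin K → Matrix (Fin m) (Fin m) ℝ)
    (hS : ∀ l, (S l).IsSymm) : ∀ l, (scalePencil a d S l).IsSymm := fun l => (hS l).smul _

/-- `f_{scaled}(u) = f(a u)`. [folklore] -/
theorem eval_pencilDet_scale {m K : ℕ} (a : ℝ) (d : Fin K → ℕ) (S : Fin K → Matrix (Fin m) (Fin m) ℝ) (u : ℝ) :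
    (pencilDet d (scalePencil a d S)).eval u = (pencilDet d S).eval (a * u) := by
  rw [eval_pencilDet, eval_pencilDet]
  congr 1
  refine Finset.sum_congr rfl fun l _ => ?_
  rw [scalePencil, smul_smul, mul_pow, mul_comm]

/-- Rescaling by `a ≠ 0` keeps the pencil determinant nonzero. [folklore] -/
theorem pencilDet_scale_ne_zero {m K : ℕ} (a : ℝ) (ha : a ≠ 0) (d : Fin K → ℕ) (S : Fin K → Matrix (Fin m) (Fin m) ℝ)
    (h : pencilDet d S ≠ 0) : pencilDet d (scalePencil a d S) ≠ 0 := by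
  intro h0
  apply h
  apply Polynomial.funext
  intro x
  have := eval_pencilDet_scale a d S (x / a)
  rw [h0, Polynomial.eval_zero, mul_div_cancel₀ _ ha] at this
  rw [← this, Polynomial.eval_zero]

/-- per-octave census row: every real symmetric lacunary pencil of format `(m, K)` has at most `P` distinct real roots `x` with
`|x| ∈ [1, 2)` (equivalently, by the rescaling `S_l ↦ 2^{j d_l} S_l`, in ANY dyadic octave). -/
def PerOctaveRootLawAt (m K P : ℕ) : Prop :=
  ∀ (d : Fin K → ℕ) (S : Fin K → Matrix (Fin m) (Fin m) ℝ), (∀ l, (S l).IsSymm) →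
    ((pencilDet d S).roots.toFinset.filter (fun x => 1 ≤ |x| ∧ |x| < 2)).card ≤ P

/-- roots in the octave `j` are at most the per-octave row bound (rescaling). [folklore] -/
theorem card_roots_octave_le {m K P : ℕ} (h : PerOctaveRootLawAt m K P) (d : Fin K → ℕ)
    (S : Fin K → Matrix (Fin m) (Fin m) ℝ) (hS : ∀ l, (S l).IsSymm) (j : ℤ) :
    (((pencilDet d S).roots.toFinset.filter (fun x => x ≠ 0)).filter (fun x => octave x = j)).card ≤ P := by
  classical
  set a : ℝ := (2 : ℝ) ^ j with ha
  have ha0 : 0 < a := zpow_pos (by norm_num) _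
  have hb := h d (scalePencil a d S) (scalePencil_isSymm a d S hS)
  refine le_trans ?_ hb
  apply Finset.card_le_card_of_injOn (fun x => x / a)
  · intro x hx
    rw [Finset.mem_coe, mem_filter, mem_filter, Multiset.mem_toFinset] at hx
    obtain ⟨⟨hxr, hx0⟩, hxj⟩ := hx
    have hp : pencilDet d S ≠ 0 := (mem_roots'.1 hxr).1
    have hroot : (pencilDet d S).IsRoot x := (mem_roots'.1 hxr).2
    rw [Finset.mem_coe, mem_filter, Multiset.mem_toFinset, mem_roots (pencilDet_scale_ne_zero a ha0.ne' d S hp), IsRoot,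
      eval_pencilDet_scale, mul_div_cancel₀ _ ha0.ne']
    refine ⟨hroot, ?_, ?_⟩
    · rw [abs_div, abs_of_pos ha0, le_div_iff₀ ha0, one_mul, ha]
      have hxpos : 0 < |x| := abs_pos.2 hx0
      have := Int.zpow_log_le_self (b := 2) (by norm_num) hxpos
      rw [octave] at hxj
      rw [hxj] at this
      exact_mod_cast this
    · rw [abs_div, abs_of_pos ha0, div_lt_iff₀ ha0, ha]
      have hxpos : 0 < |x| := abs_pos.2 hx0
      have := Int.lt_zpow_succ_log_self (b := 2) (by norm_num) |x|
      rw [octave] at hxj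
      rw [hxj] at this
      have e : ((2 : ℕ) : ℝ) ^ (j + 1) = 2 * (2 : ℝ) ^ j := by
        rw [Nat.cast_ofNat, zpow_add_one₀ (by norm_num : (2:ℝ) ≠ 0), mul_comm]
      rw [e] at this
      exact this
  · intro x _ y _ hxy
    simpa [div_left_inj' ha0.ne'] using hxy

/-- **scales × clusters**: the number of distinct real roots is at most `1 + Ω · P`. [folklore] -/
theorem card_roots_le_one_add_octave_mul {m K P : ℕ} (h : PerOctaveRootLawAt m K P) (d : Fin K → ℕ)
    (S : Fin K → Matrix (Fin m) (Fin m) ℝ) (hS : ∀ l, (S l).IsSymm) :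
    (pencilDet d S).roots.toFinset.card ≤ 1 + P * octaveCount (pencilDet d S) := by
  classical
  set R := (pencilDet d S).roots.toFinset with hR
  have h1 : R.card ≤ (R.filter (fun x => x = 0)).card + (R.filter (fun x => x ≠ 0)).card := by
    rw [← Finset.card_filter_add_card_filter_not (p := fun x => x = 0)]
  have h0 : (R.filter (fun x => x = 0)).card ≤ 1 := by
    calc (R.filter (fun x => x = 0)).card ≤ ({0} : Finset ℝ).card :=
          Finset.card_le_card (fun x hx => by rw [mem_filter] at hx; simp [hx.2])
      _ = 1 := card_singleton 0
  have h2 : (R.filter (fun x => x ≠ 0)).card ≤ P * ((R.filter (fun x => x ≠ 0)).image octave).card :=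
    Finset.card_le_mul_card_image _ P fun j _ => card_roots_octave_le h d S hS j
  unfold octaveCount
  rw [← hR]
  omega


/-- **PO-B**, the per-octave `K + log² m` law (NOT asserted): at most `2^{C(K+log² m)}` distinct real roots in any single dyadic octave.
EQUIVALENT TO CONJECTURE B (`kPlusLogSqLaw_iff_perOctaveKLaw`, odd degree dilation compresses all root scales into one octave) — so it is
NOT a weaker «cluster half»; recorded here because the equivalence «B localises to one octave» is itself informative. -/
def PerOctaveKLaw : Prop := ∃ C : ℕ, ∀ m K : ℕ, PerOctaveRootLawAt m K (2 ^ (C * (K + Nat.log 2 m ^ 2)))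

/-- B ⇒ PO-B. [folklore] -/
theorem perOctaveKLaw_of_kPlusLogSqLaw (h : KPlusLogSqLaw) : PerOctaveKLaw := by
  obtain ⟨C, hC⟩ := h
  exact ⟨C, fun m K d S hS => (card_filter_le _ _).trans (hC m K d S hS)⟩

/-- octave row ∧ per-octave row ⇒ root-count row (tree currency `RealRootLawAt`). [folklore] -/
theorem realRootLawAt_of_octave_of_perOctave {m K B P : ℕ} (hΩ : OctaveRootLawAt m K B) (hP : PerOctaveRootLawAt m K P) :
    RealRootLawAt m K (1 + P * B) := fun d S hS =>
  (card_roots_le_one_add_octave_mul hP d S hS).trans (by have := hΩ d S hS; unfold pencilDet at this ⊢; nlinarith)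

/-- **Ω-B ∧ PO-B ⇒ B.** [folklore] -/
theorem kPlusLogSqLaw_of_octaveKLaw_of_perOctaveKLaw (hΩ : OctaveKLaw) (hP : PerOctaveKLaw) : KPlusLogSqLaw := by
  obtain ⟨C₁, h₁⟩ := hΩ
  obtain ⟨C₂, h₂⟩ := hP
  refine ⟨C₁ + C₂ + 1, fun m K => ?_⟩
  rcases Nat.eq_zero_or_pos K with hK | hK
  · subst hK
    intro d S _
    have h0 : (∑ l : Fin 0, ((Polynomial.X : Polynomial ℝ) ^ d l) • (S l).map Polynomial.C) = 0 := by simp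
    rw [h0]
    rcases Nat.eq_zero_or_pos m with hm | hm
    · subst hm
      simp [Matrix.det_isEmpty]
    · haveI : Nonempty (Fin m) := ⟨⟨0, hm⟩⟩
      simp [Matrix.det_zero]
  · have h := realRootLawAt_of_octave_of_perOctave (h₁ m K) (h₂ m K)
    refine Summit.ValiantsHypothesis.ValiantsHypothesis.Theorems.LacunarySymmetroidMatrixDescartes.Census.realRootLawAt_mono ?_ h
    have hE : 1 ≤ K + Nat.log 2 m ^ 2 := by omega
    calc 1 + 2 ^ (C₂ * (K + Nat.log 2 m ^ 2)) * 2 ^ (C₁ * (K + Nat.log 2 m ^ 2))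
        = 1 + 2 ^ ((C₁ + C₂) * (K + Nat.log 2 m ^ 2)) := by rw [← pow_add]; ring_nf
      _ ≤ 2 ^ ((C₁ + C₂) * (K + Nat.log 2 m ^ 2) + 1) := by
          have h1 := Nat.one_le_two_pow (n := (C₁ + C₂) * (K + Nat.log 2 m ^ 2))
          have e : 2 ^ ((C₁ + C₂) * (K + Nat.log 2 m ^ 2) + 1) = 2 * 2 ^ ((C₁ + C₂) * (K + Nat.log 2 m ^ 2)) := by
            rw [pow_succ, mul_comm]
          rw [e]; omega
      _ ≤ 2 ^ ((C₁ + C₂ + 1) * (K + Nat.log 2 m ^ 2)) := Nat.pow_le_pow_right (by norm_num) (by nlinarith)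

/-- **B ⟺ Ω-B ∧ PO-B** (scales × clusters).  Valiant's hypothesis consumes only the first conjunct (`valiant_of_octaveKLaw`); the second
conjunct is B itself (`kPlusLogSqLaw_iff_perOctaveKLaw` below), so the informative reading is one-directional: Ω-B is the weaker door. [folklore] -/
theorem kPlusLogSqLaw_iff_octave_and_perOctave : KPlusLogSqLaw ↔ OctaveKLaw ∧ PerOctaveKLaw :=
  ⟨fun h => ⟨octaveKLaw_of_kPlusLogSqLaw h, perOctaveKLaw_of_kPlusLogSqLaw h⟩,
    fun h => kPlusLogSqLaw_of_octaveKLaw_of_perOctaveKLaw h.1 h.2⟩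

/-! ### Degree dilation (v5 correction): PO-B ⇒ B, so `B ↔ PO-B` — Conjecture B localises to one octave -/

/-- degree dilation `d ↦ q·d` (same format). -/
def dilate {K : ℕ} (q : ℕ) (d : Fin K → ℕ) : Fin K → ℕ := fun l => q * d l

/-- `f_{q·d}(u) = f_d(u^q)`. [folklore] -/
theorem eval_pencilDet_dilate {m K : ℕ} (q : ℕ) (d : Fin K → ℕ) (S : Fin K → Matrix (Fin m) (Fin m) ℝ) (u : ℝ) :
    (pencilDet (dilate q d) S).eval u = (pencilDet d S).eval (u ^ q) := by
  rw [eval_pencilDet, eval_pencilDet]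
  congr 1
  refine Finset.sum_congr rfl fun l _ => ?_
  rw [dilate, ← pow_mul]

/-- dilation by `q ≥ 1` keeps the pencil determinant nonzero. [folklore] -/
theorem pencilDet_dilate_ne_zero {m K : ℕ} (q : ℕ) (hq : 0 < q) (d : Fin K → ℕ) (S : Fin K → Matrix (Fin m) (Fin m) ℝ)
    (h : pencilDet d S ≠ 0) : pencilDet (dilate q d) S ≠ 0 := by
  intro h0
  apply h
  apply Polynomial.eq_zero_of_infinite_isRoot
  apply Set.Infinite.mono (s := Set.Ioi (0 : ℝ))
  · intro t ht
    have ht0 : (0 : ℝ) ≤ t := le_of_lt ht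
    have := eval_pencilDet_dilate q d S (t ^ ((q : ℝ)⁻¹))
    rw [h0, Polynomial.eval_zero, Real.rpow_inv_natCast_pow ht0 hq.ne'] at this
    exact this.symm
  · exact Set.Ioi_infinite 0

/-- **positive roots ≤ per-octave bound** (odd dilation compresses all positive root scales into one octave). [folklore] -/
theorem card_pos_roots_le {m K P : ℕ} (h : PerOctaveRootLawAt m K P) (d : Fin K → ℕ)
    (S : Fin K → Matrix (Fin m) (Fin m) ℝ) (hS : ∀ l, (S l).IsSymm) :
    ((pencilDet d S).roots.toFinset.filter (fun x => 0 < x)).card ≤ P := by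
  classical
  set R := (pencilDet d S).roots.toFinset.filter (fun x => 0 < x) with hR
  -- a common scale window 2^{-A} ≤ t ≤ 2^{A}
  set A : ℕ := ∑ t ∈ R, ⌈|Real.logb 2 t|⌉₊ with hA
  have hwin : ∀ t ∈ R, |Real.logb 2 t| ≤ A := by
    intro t ht
    calc |Real.logb 2 t| ≤ (⌈|Real.logb 2 t|⌉₊ : ℝ) := Nat.le_ceil _
      _ ≤ ((∑ t ∈ R, ⌈|Real.logb 2 t|⌉₊ : ℕ) : ℝ) := by
          exact_mod_cast Finset.single_le_sum (f := fun t => ⌈|Real.logb 2 t|⌉₊) (fun _ _ => Nat.zero_le _) ht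
  set q : ℕ := 2 * A + 1 with hq
  have hq0 : 0 < q := by omega
  have hqR : (0 : ℝ) < q := by exact_mod_cast hq0
  -- compressed and centred pencil
  set c : ℝ := (2 : ℝ) ^ (-(1 / 2 : ℝ)) with hc
  have hc0 : 0 < c := Real.rpow_pos_of_pos (by norm_num) _
  set S' := scalePencil c (dilate q d) S with hS'
  have hb := h (dilate q d) S' (scalePencil_isSymm c _ S hS)
  refine le_trans ?_ hb
  -- the map t ↦ 2^{1/2} t^{1/q}
  let f : ℝ → ℝ := fun t => (2 : ℝ) ^ (1 / 2 : ℝ) * t ^ ((q : ℝ)⁻¹)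
  have hcf : ∀ t, 0 ≤ t → (c * f t) ^ q = t := by
    intro t ht
    have : c * (2 : ℝ) ^ (1 / 2 : ℝ) = 1 := by
      rw [hc, ← Real.rpow_add (by norm_num : (0 : ℝ) < 2)]; norm_num
    show (c * ((2 : ℝ) ^ (1 / 2 : ℝ) * t ^ ((q : ℝ)⁻¹))) ^ q = t
    rw [← mul_assoc, this, one_mul, Real.rpow_inv_natCast_pow ht hq0.ne']
  apply Finset.card_le_card_of_injOn f
  · intro t ht
    rw [Finset.mem_coe, hR, mem_filter, Multiset.mem_toFinset] at ht
    obtain ⟨htr, ht0⟩ := ht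
    have hp : pencilDet d S ≠ 0 := (mem_roots'.1 htr).1
    have hroot : (pencilDet d S).IsRoot t := (mem_roots'.1 htr).2
    have hp' : pencilDet (dilate q d) S' ≠ 0 :=
      pencilDet_scale_ne_zero c hc0.ne' _ S (pencilDet_dilate_ne_zero q hq0 d S hp)
    rw [Finset.mem_coe, mem_filter, Multiset.mem_toFinset, mem_roots hp', IsRoot, hS', eval_pencilDet_scale,
      eval_pencilDet_dilate, hcf t ht0.le]
    refine ⟨hroot, ?_⟩
    -- window: 1 ≤ 2^{1/2} t^{1/q} < 2
    have hft : 0 < f t := mul_pos (Real.rpow_pos_of_pos (by norm_num) _) (Real.rpow_pos_of_pos ht0 _)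
    rw [abs_of_pos hft]
    have hlog : Real.logb 2 (f t) = 1 / 2 + (q : ℝ)⁻¹ * Real.logb 2 t := by
      show Real.logb 2 ((2 : ℝ) ^ (1 / 2 : ℝ) * t ^ ((q : ℝ)⁻¹)) = _
      rw [Real.logb_mul (Real.rpow_pos_of_pos (by norm_num) _).ne' (Real.rpow_pos_of_pos ht0 _).ne',
        Real.logb_rpow (by norm_num) (by norm_num), Real.logb_rpow_eq_mul_logb_of_pos ht0]
    have hw := hwin t (by rw [hR, mem_filter, Multiset.mem_toFinset]; exact ⟨htr, ht0⟩)
    have hAq : (A : ℝ) * (q : ℝ)⁻¹ < 1 / 2 := by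
      rw [← div_eq_mul_inv, div_lt_iff₀ hqR, hq]; push_cast; linarith
    have habs := abs_le.1 hw
    have hqi : (0 : ℝ) < (q : ℝ)⁻¹ := inv_pos.2 hqR
    have hlo : 0 ≤ Real.logb 2 (f t) := by
      rw [hlog]; nlinarith [habs.1, hqi, hAq]
    have hhi : Real.logb 2 (f t) < 1 := by
      rw [hlog]; nlinarith [habs.2, hqi, hAq]
    constructor
    · have := (Real.logb_nonneg_iff (by norm_num : (1:ℝ) < 2) hft).1 hlo
      exact this
    · have := (Real.logb_lt_iff_lt_rpow (by norm_num : (1:ℝ) < 2) hft).1 hhi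
      simpa using this
  · intro t₁ ht₁ t₂ ht₂ hft
    rw [Finset.mem_coe, hR, mem_filter] at ht₁ ht₂
    have e1 := hcf t₁ ht₁.2.le
    have e2 := hcf t₂ ht₂.2.le
    have : f t₁ = f t₂ := hft
    rw [← e1, ← e2, this]

/-- negative roots of `f` are positive roots of `u ↦ f(−u)` (a rescaling by `−1`). [folklore] -/
theorem card_neg_roots_le {m K P : ℕ} (h : PerOctaveRootLawAt m K P) (d : Fin K → ℕ)
    (S : Fin K → Matrix (Fin m) (Fin m) ℝ) (hS : ∀ l, (S l).IsSymm) :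
    ((pencilDet d S).roots.toFinset.filter (fun x => x < 0)).card ≤ P := by
  classical
  have hb := card_pos_roots_le h d (scalePencil (-1) d S) (scalePencil_isSymm (-1) d S hS)
  refine le_trans ?_ hb
  apply Finset.card_le_card_of_injOn (fun x => -x)
  · intro x hx
    rw [Finset.mem_coe, mem_filter, Multiset.mem_toFinset] at hx
    obtain ⟨hxr, hx0⟩ := hx
    have hp : pencilDet d S ≠ 0 := (mem_roots'.1 hxr).1
    have hroot : (pencilDet d S).IsRoot x := (mem_roots'.1 hxr).2
    rw [Finset.mem_coe, mem_filter, Multiset.mem_toFinset,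
      mem_roots (pencilDet_scale_ne_zero (-1) (by norm_num) d S hp), IsRoot, eval_pencilDet_scale]
    refine ⟨by simpa using hroot, by linarith⟩
  · intro x _ y _ hxy; simpa using hxy

/-- **PO-row ⇒ real row**: `Z ≤ 2P + 1`. [folklore] -/
theorem realRootLawAt_of_perOctave {m K P : ℕ} (h : PerOctaveRootLawAt m K P) : RealRootLawAt m K (2 * P + 1) := by
  classical
  intro d S hS
  set R := (Matrix.det (∑ l, ((Polynomial.X : Polynomial ℝ) ^ d l) • (S l).map Polynomial.C)).roots.toFinset with hR
  have hR' : R = (pencilDet d S).roots.toFinset := rfl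
  have hsub : R ⊆ (R.filter (fun x => 0 < x) ∪ R.filter (fun x => x < 0)) ∪ {0} := by
    intro x hx
    rcases lt_trichotomy x 0 with hl | he | hg
    · exact mem_union_left _ (mem_union_right _ (mem_filter.2 ⟨hx, hl⟩))
    · exact mem_union_right _ (by simp [he])
    · exact mem_union_left _ (mem_union_left _ (mem_filter.2 ⟨hx, hg⟩))
  have h1 := card_pos_roots_le h d S hS
  have h2 := card_neg_roots_le h d S hS
  rw [← hR'] at h1 h2
  calc R.card ≤ ((R.filter (fun x => 0 < x) ∪ R.filter (fun x => x < 0)) ∪ {0}).card := card_le_card hsub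
    _ ≤ (R.filter (fun x => 0 < x) ∪ R.filter (fun x => x < 0)).card + ({0} : Finset ℝ).card := card_union_le _ _
    _ ≤ ((R.filter (fun x => 0 < x)).card + (R.filter (fun x => x < 0)).card) + 1 :=
        Nat.add_le_add (card_union_le _ _) (by simp)
    _ ≤ 2 * P + 1 := by omega

/-- **PO-B ⇒ B**: the per-octave `K + log² m` law IS Conjecture B (up to the constant). [folklore] -/
theorem kPlusLogSqLaw_of_perOctaveKLaw (h : PerOctaveKLaw) : KPlusLogSqLaw := by
  obtain ⟨C, hC⟩ := h
  refine ⟨C + 2, fun m K => ?_⟩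
  have hrow := realRootLawAt_of_perOctave (hC m K)
  rcases Nat.eq_zero_or_pos (K + Nat.log 2 m ^ 2) with hE | hE
  · -- K = 0: no letters, no roots
    have hK : K = 0 := by omega
    subst hK
    intro d S _
    have h0 : (∑ l : Fin 0, ((Polynomial.X : Polynomial ℝ) ^ d l) • (S l).map Polynomial.C) = 0 := by simp
    rw [h0]
    rcases Nat.eq_zero_or_pos m with hm | hm
    · subst hm; simp [Matrix.det_isEmpty]
    · haveI : Nonempty (Fin m) := ⟨⟨0, hm⟩⟩
      simp [Matrix.det_zero]
  · refine Summit.ValiantsHypothesis.ValiantsHypothesis.Theorems.LacunarySymmetroidMatrixDescartes.Census.realRootLawAt_mono ?_ hrow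
    set E := K + Nat.log 2 m ^ 2
    have hx : 1 ≤ 2 ^ (C * E) := Nat.one_le_two_pow
    calc 2 * 2 ^ (C * E) + 1 ≤ 2 ^ (C * E + 2) := by rw [pow_add]; omega
      _ ≤ 2 ^ ((C + 2) * E) := Nat.pow_le_pow_right (by norm_num) (by nlinarith)

/-- **B ⟺ PO-B** (v5): Conjecture B is equivalent to its restriction to the single octave `|x| ∈ [1,2)`. [folklore] -/
theorem kPlusLogSqLaw_iff_perOctaveKLaw : KPlusLogSqLaw ↔ PerOctaveKLaw :=
  ⟨perOctaveKLaw_of_kPlusLogSqLaw, kPlusLogSqLaw_of_perOctaveKLaw⟩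

/-- hence PO-B alone already gives the octave law (and everything B gives). [folklore] -/
theorem octaveKLaw_of_perOctaveKLaw (h : PerOctaveKLaw) : OctaveKLaw :=
  octaveKLaw_of_kPlusLogSqLaw (kPlusLogSqLaw_of_perOctaveKLaw h)

/-- **Lens «assume the law fails» — formally a trichotomy, honestly a DICHOTOMY WITH REMAINDER (kernel).**  If Conjecture B fails then
EITHER the tropical row is super-polynomial (`¬TropicalB`), OR octave lifting fails (`¬OctaveWeakLifting`: super-polynomially many root
SCALES beyond the design's breakpoints — by `rootNearBreakpoint_proof` this forces unbounded cancellation depth), OR `¬PerOctaveKLaw` — and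
the third disjunct is `¬B` REWORDED (`kPlusLogSqLaw_iff_perOctaveKLaw`: every ¬B family has a one-octave avatar in the same format by odd
degree dilation), so it carries no information of its own.  The content is: the Valiant door of this line needs exactly
`TropicalB ∧ OctaveWeakLifting`, and a ¬B family closes it only if it is (or dilates to) a tropical or a deep-spread monster; a ¬B family
with boundedly many root SCALES per tropical budget leaves the door open.  Nothing here asserts which case (if any) occurs. [folklore] -/
theorem notB_trichotomy (hB : ¬ KPlusLogSqLaw) : ¬ TropicalB ∨ ¬ OctaveWeakLifting ∨ ¬ PerOctaveKLaw := by
  by_contra h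
  push Not at h
  obtain ⟨hT, hW, hP⟩ := h
  exact hB (kPlusLogSqLaw_of_octaveKLaw_of_perOctaveKLaw (octaveKLaw_of_tropicalB_of_octaveWeakLifting hT hW) hP)

-- (`valiant_door_ignores_clusters` of the deposit = `valiant_of_tropicalB_of_octaveWeakLifting` verbatim; not re-declared.)

end ScalesClusters

end Summit.ValiantsHypothesis.ValiantsHypothesis.Theorems.KPlusLogSqLaw.Octave
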